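import Mathlib
import Summits.Ventures.HodgeRepro.Tier4.Common.RowPlane
import Summits.Ventures.HodgeRepro.Tier4.Line1.PlaneDefs

/-!
# Tier4/Line1/RowPlaneGenuine — LINE L1's plane predicates `IsGenuineRow` / `IsDefinite` on typer-2's ROW planes
(the (I0) seesaw plane of `line1_realise`, DEFINED half)

Blind re-derivation cell `pub-hodge-repro`, Tier 4 (README §9–§10), seat t4-L1-p3 (gen 2).  Target tree path
`lean/Summits/Ventures/HodgeRepro/Tier4/Line1/RowPlaneGenuine.lean`.  Imports `Common.RowPlane` (typer-2:
`QuadData`, `omegaMat`, `lineGramRow`, `blockDiag4`, `PlaneData.ofLinesRow`, `ofLinesRow_isHermitianRow`,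
`ofLinesRow_P_mul_B`, and through it `MixedPlaneKType.PlaneData.withTransportedTorus`) and `Line1.PlaneDefs`
(`IsDefinite`, `IsGenuineRow`).

WHAT THIS IS.  The costume lemma `line1_realise` of LINE L1 (Skeleton v0.31 L1226) constructs, among its (I0) data,
«`pl` = the seesaw plane `W = W₀ ⊕ W₁` in a `k`-basis (definite at `w₀ = τ₀|_{E′⁺}`, Liu 2021 Lemma D.2(2); GENUINE in
the ROW convention, `IsGenuineRow`)».  Every hermitian plane over `E′ = k(ω)` with a diagonal basis is typer-2's
`PlaneData.ofLinesRow q a b ε` (the lines `⟨a⟩`, `⟨ε b⟩`; `q = (t, n)` the trace and norm of `ω`) with, possibly, the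
second torus transported by an `E′`-linear isometry `g` (`withTransportedTorus`).  This file proves, for a
TRACE-ZERO generator (`q.t = 0`, i.e. `c(ω) = −ω`, `ω² = −n`; every CM extension has one), that these planes satisfy
LINE L1's two predicates:
* `isGenuineRow_ofLinesRow` — `IsGenuineRow (ofLinesRow q a b ε)` for `a, b, ε ≠ 0` and `−n` not a square in `k`
  (`Ω² = −n`, `Ω B = −B Ωᵀ`, the projectors `B`-self-adjoint of rank `2`);
* `isGenuineRow_withTransportedTorus` — `IsGenuineRow` is preserved by transporting the second torus along an
  `E′`-linear ISOMETRY (`g Ω = Ω g`, `g B gᵀ = B`; the `B`-self-adjointness of `g P g⁻¹` needs the isometry);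
* `isDefinite_ofLinesRow` — `IsDefinite (ofLinesRow q a b ε)` at a real embedding `σ` with `σ(n) > 0` at which the
  two line scalars `a`, `ε b` have the same sign (the row Gram is `diag(2an, 2a, 2εbn, 2εb)`), and the same for the
  transported plane (`B` is unchanged).
Nothing here is about the characters or the free half of the costume: this is the DEFINED input `hdef ∧ hgen` of
`exists_rtfDatum_defined` on the concrete plane.  Nothing here says anything about the status of the Hodge conjecture
for CM abelian varieties, which is NOT proved (HC_CM is NOT proved by anyone in this repository).
-/

set_option autoImplicit false

noncomputable section

namespace Summit.Ventures.HodgeRepro.Tier4.Line1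

open Common Matrix

section Rank

variable {k : Type} [Field k]

/-- The block matrix `fromBlocks 1 0 0 0` is the diagonal matrix of `Sum.elim 1 0`. -/
theorem fromBlocks_one_zero_eq_diagonal : (fromBlocks (1 : Matrix (Fin 2) (Fin 2) k) 0 0 0) =
    diagonal (Sum.elim (fun _ : Fin 2 => (1 : k)) (fun _ : Fin 2 => (0 : k))) := by
  ext i j
  rcases i with i | i <;> rcases j with j | j <;> simp [fromBlocks, diagonal, one_apply]

/-- The block matrix `fromBlocks 0 0 0 1` is the diagonal matrix of `Sum.elim 0 1`. -/
theorem fromBlocks_zero_one_eq_diagonal : (fromBlocks (0 : Matrix (Fin 2) (Fin 2) k) 0 0 1) =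
    diagonal (Sum.elim (fun _ : Fin 2 => (0 : k)) (fun _ : Fin 2 => (1 : k))) := by
  ext i j
  rcases i with i | i <;> rcases j with j | j <;> simp [fromBlocks, diagonal, one_apply]

open Classical in
/-- `Sum.elim 1 0` on `Fin 2 ⊕ Fin 2` is non-zero at exactly two indices. -/
theorem card_ne_zero_sumElim_one_zero :
    Fintype.card {i : Fin 2 ⊕ Fin 2 // Sum.elim (fun _ : Fin 2 => (1 : k)) (fun _ : Fin 2 => (0 : k)) i ≠ 0} = 2 := by
  have e : {i : Fin 2 ⊕ Fin 2 // Sum.elim (fun _ : Fin 2 => (1 : k)) (fun _ : Fin 2 => (0 : k)) i ≠ 0} ≃ Fin 2 :=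
    { toFun := fun x => match x with
        | ⟨Sum.inl a, _⟩ => a
        | ⟨Sum.inr _, h⟩ => absurd rfl h
      invFun := fun a => ⟨Sum.inl a, one_ne_zero⟩
      left_inv := by
        rintro ⟨i, hi⟩
        rcases i with a | b
        · rfl
        · exact absurd rfl hi
      right_inv := fun a => rfl }
  rw [Fintype.card_congr e, Fintype.card_fin]

open Classical in
/-- `Sum.elim 0 1` on `Fin 2 ⊕ Fin 2` is non-zero at exactly two indices. -/
theorem card_ne_zero_sumElim_zero_one :
    Fintype.card {i : Fin 2 ⊕ Fin 2 // Sum.elim (fun _ : Fin 2 => (0 : k)) (fun _ : Fin 2 => (1 : k)) i ≠ 0} = 2 := by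
  have e : {i : Fin 2 ⊕ Fin 2 // Sum.elim (fun _ : Fin 2 => (0 : k)) (fun _ : Fin 2 => (1 : k)) i ≠ 0} ≃ Fin 2 :=
    { toFun := fun x => match x with
        | ⟨Sum.inr a, _⟩ => a
        | ⟨Sum.inl _, h⟩ => absurd rfl h
      invFun := fun a => ⟨Sum.inr a, one_ne_zero⟩
      left_inv := by
        rintro ⟨i, hi⟩
        rcases i with a | b
        · exact absurd rfl hi
        · rfl
      right_inv := fun a => rfl }
  rw [Fintype.card_congr e, Fintype.card_fin]

/-- **The first projector of a row plane has rank `2`**: `blockDiag4 1 0` is a reindexed diagonal matrix with two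
non-zero entries. -/
theorem rank_blockDiag4_one_zero : (blockDiag4 (1 : Matrix (Fin 2) (Fin 2) k) 0).rank = 2 := by
  classical
  unfold blockDiag4 re4
  rw [coe_reindexAlgEquiv, rank_reindex, fromBlocks_one_zero_eq_diagonal, rank_diagonal]
  convert card_ne_zero_sumElim_one_zero (k := k)

/-- **The second projector of a row plane has rank `2`**. -/
theorem rank_blockDiag4_zero_one : (blockDiag4 (0 : Matrix (Fin 2) (Fin 2) k) 1).rank = 2 := by
  classical
  unfold blockDiag4 re4
  rw [coe_reindexAlgEquiv, rank_reindex, fromBlocks_zero_one_eq_diagonal, rank_diagonal]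
  convert card_ne_zero_sumElim_zero_one (k := k)

/-- Negation of a block-diagonal matrix. -/
theorem blockDiag4_neg (A D : Matrix (Fin 2) (Fin 2) k) : blockDiag4 (-A) (-D) = -blockDiag4 A D := by
  simp only [blockDiag4, ← map_neg, Matrix.fromBlocks_neg, neg_zero]

/-- A block-diagonal matrix with diagonal blocks is diagonal (indices through `finSumFinEquiv`). -/
theorem blockDiag4_diagonal (d₁ d₂ : Fin 2 → k) :
    blockDiag4 (diagonal d₁) (diagonal d₂) =
      diagonal (fun i : Fin 4 => Sum.elim d₁ d₂ ((finSumFinEquiv : Fin 2 ⊕ Fin 2 ≃ Fin 4).symm i)) := by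
  simp only [blockDiag4, re4, coe_reindexAlgEquiv, fromBlocks_diagonal, reindex_apply, submatrix_diagonal_equiv]
  rfl

end Rank

section Genuine

variable {k : Type} [Field k] (q : QuadData k)

/-- For a trace-zero generator the row line Gram matrix is `diag(2an, 2a)`. -/
theorem lineGramRow_eq_diagonal (a : k) (ht : q.t = 0) :
    lineGramRow q a = diagonal ![a * (2 * q.n), a * 2] := by
  ext i j
  fin_cases i <;> fin_cases j <;> simp [lineGramRow, ht, diagonal]

/-- For a trace-zero generator the scaled row line Gram matrix is `diag(2εbn, 2εb)`. -/
theorem smul_lineGramRow_eq_diagonal (ε b : k) (ht : q.t = 0) :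
    ε • lineGramRow q b = diagonal ![(ε * b) * (2 * q.n), (ε * b) * 2] := by
  ext i j
  fin_cases i <;> fin_cases j <;> simp [lineGramRow, ht, diagonal] <;> ring

/-- For a trace-zero generator the row plane's `Ω` squares to `−n`. -/
theorem ofLinesRow_Ω_sq (a b ε : k) (ht : q.t = 0) :
    (PlaneData.ofLinesRow q a b ε).Ω * (PlaneData.ofLinesRow q a b ε).Ω =
      -(q.n • (1 : Matrix (Fin 4) (Fin 4) k)) := by
  show blockDiag4 (omegaMat q) (omegaMat q) * blockDiag4 (omegaMat q) (omegaMat q) = _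
  rw [blockDiag4_mul, omegaMat_sq, ht, zero_smul, zero_sub, ← blockDiag4_one, blockDiag4_smul, blockDiag4_neg]

/-- For a trace-zero generator the row plane's Gram matrix is the diagonal matrix `diag(2an, 2a, 2εbn, 2εb)`. -/
theorem ofLinesRow_B_eq_diagonal (a b ε : k) (ht : q.t = 0) :
    (PlaneData.ofLinesRow q a b ε).B =
      diagonal (fun i : Fin 4 => Sum.elim ![a * (2 * q.n), a * 2] ![(ε * b) * (2 * q.n), (ε * b) * 2]
        ((finSumFinEquiv : Fin 2 ⊕ Fin 2 ≃ Fin 4).symm i)) := by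
  rw [ofLinesRow_B, lineGramRow_eq_diagonal q a ht, smul_lineGramRow_eq_diagonal q ε b ht, blockDiag4_diagonal]

/-- **LINE L1's `IsGenuineRow` for typer-2's row plane** (`a, b, ε ≠ 0`, trace-zero generator with `−n` not a
square in `k`): `Ω² = −n`, `Ω B = −B Ωᵀ`, the projectors of both tori are `B`-self-adjoint of rank `2`. -/
theorem isGenuineRow_ofLinesRow [CharZero k] (a b ε : k) (ha : a ≠ 0) (hb : b ≠ 0) (hε : ε ≠ 0) (ht : q.t = 0)
    (hn : ¬ IsSquare (-q.n)) : IsGenuineRow (PlaneData.ofLinesRow q a b ε) := by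
  have hn0 : q.n ≠ 0 := by
    intro h0
    apply hn
    rw [h0, neg_zero]
    exact ⟨0, by simp⟩
  have hq : q.t ^ 2 - 4 * q.n ≠ 0 := by
    rw [ht]
    intro h0
    apply hn0
    have h4 : (4 : k) * q.n = 0 := by linear_combination -h0
    exact (mul_eq_zero.mp h4).resolve_left (by norm_num)
  refine ⟨⟨q.n, ofLinesRow_Ω_sq q a b ε ht, hn⟩,
    IsHermitianPlaneRow.omega_mul_B_of_t_eq_zero q (ofLinesRow_isHermitianRow q a b ε ha hb hε hq) ht,
    ofLinesRow_P_mul_B q a b ε, ofLinesRow_P_mul_B q a b ε, ?_, ?_⟩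
  · intro i
    fin_cases i
    · exact rank_blockDiag4_one_zero
    · exact rank_blockDiag4_zero_one
  · intro i
    fin_cases i
    · exact rank_blockDiag4_one_zero
    · exact rank_blockDiag4_zero_one

/-- **`IsGenuineRow` is preserved by transporting the second torus along an `E′`-linear isometry** (`g Ω = Ω g`,
`g B gᵀ = B`): the transported projectors `g P g⁻¹` are `B`-self-adjoint (`B gᵀ = g⁻¹ B`, `B (g⁻¹)ᵀ = g B`) and of
rank `2`. -/
theorem isGenuineRow_withTransportedTorus (W : PlaneData k) (hW : IsGenuineRow W)
    (g g' : Matrix (Fin 4) (Fin 4) k) (hgg' : g * g' = 1) (hg'g : g' * g = 1) (hgΩ : g * W.Ω = W.Ω * g)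
    (hgB : g * W.B * gᵀ = W.B) : IsGenuineRow (W.withTransportedTorus g g' hgg' hg'g hgΩ) := by
  obtain ⟨hd, hΩB, hP, -, hPr, -⟩ := hW
  refine ⟨hd, hΩB, hP, ?_, hPr, ?_⟩
  · intro i
    show g * W.P i * g' * W.B = W.B * (g * W.P i * g')ᵀ
    have h1 : W.B * gᵀ = g' * W.B := by
      calc W.B * gᵀ = (g' * g) * W.B * gᵀ := by rw [hg'g, Matrix.one_mul]
        _ = g' * (g * W.B * gᵀ) := by simp only [Matrix.mul_assoc]
        _ = g' * W.B := by rw [hgB]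
    have h2 : W.B * g'ᵀ = g * W.B := by
      calc W.B * g'ᵀ = (g * W.B * gᵀ) * g'ᵀ := by rw [hgB]
        _ = g * W.B * (g' * g)ᵀ := by rw [transpose_mul]; simp only [Matrix.mul_assoc]
        _ = g * W.B := by rw [hg'g, transpose_one, Matrix.mul_one]
    calc g * W.P i * g' * W.B = g * W.P i * (g' * W.B) := by simp only [Matrix.mul_assoc]
      _ = g * W.P i * (W.B * gᵀ) := by rw [h1]
      _ = g * (W.P i * W.B) * gᵀ := by simp only [Matrix.mul_assoc]
      _ = g * (W.B * (W.P i)ᵀ) * gᵀ := by rw [hP i]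
      _ = (g * W.B) * (W.P i)ᵀ * gᵀ := by simp only [Matrix.mul_assoc]
      _ = (W.B * g'ᵀ) * (W.P i)ᵀ * gᵀ := by rw [h2]
      _ = W.B * (g * W.P i * g')ᵀ := by rw [transpose_mul, transpose_mul]; simp only [Matrix.mul_assoc]
  · intro i
    show (g * W.P i * g').rank = 2
    have hg : IsUnit g.det := Matrix.isUnit_det_of_right_inverse hgg'
    have hg' : IsUnit g'.det := Matrix.isUnit_det_of_right_inverse hg'g
    rw [rank_mul_eq_left_of_isUnit_det _ _ hg', rank_mul_eq_right_of_isUnit_det _ _ hg, hPr i]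

/-- **LINE L1's `IsDefinite` for typer-2's row plane** at a real embedding `σ` of `k` with `σ(n) > 0` at which the
two line scalars `a` and `ε b` have the same sign: the row Gram `diag(2an, 2a, 2εbn, 2εb)` is then positive or
negative definite. -/
theorem isDefinite_ofLinesRow (a b ε : k) (ht : q.t = 0) (σ : k →+* ℝ) (hn : 0 < σ q.n)
    (hpos : (0 < σ a ∧ 0 < σ (ε * b)) ∨ (σ a < 0 ∧ σ (ε * b) < 0)) :
    IsDefinite (PlaneData.ofLinesRow q a b ε) := by
  refine ⟨σ, ?_⟩
  rw [ofLinesRow_B_eq_diagonal q a b ε ht, diagonal_map (map_zero σ)]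
  rcases hpos with ⟨ha, hb⟩ | ⟨ha, hb⟩ <;> rw [map_mul] at hb
  · left
    have key : ∀ j : Fin 2 ⊕ Fin 2,
        0 < σ (Sum.elim ![a * (2 * q.n), a * 2] ![(ε * b) * (2 * q.n), (ε * b) * 2] j) := by
      rintro (j | j) <;> fin_cases j
      · show 0 < σ (a * (2 * q.n))
        simp only [map_mul, map_ofNat]
        exact mul_pos ha (by linarith)
      · show 0 < σ (a * 2)
        simp only [map_mul, map_ofNat]
        exact mul_pos ha (by norm_num)
      · show 0 < σ ((ε * b) * (2 * q.n))
        simp only [map_mul, map_ofNat]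
        exact mul_pos hb (by linarith)
      · show 0 < σ ((ε * b) * 2)
        simp only [map_mul, map_ofNat]
        exact mul_pos hb (by norm_num)
    rw [posDef_diagonal_iff]
    intro i
    exact key _
  · right
    have key : ∀ j : Fin 2 ⊕ Fin 2,
        0 < -(σ (Sum.elim ![a * (2 * q.n), a * 2] ![(ε * b) * (2 * q.n), (ε * b) * 2] j)) := by
      rintro (j | j) <;> fin_cases j
      · show 0 < -(σ (a * (2 * q.n)))
        simp only [map_mul, map_ofNat]
        nlinarith [mul_pos (neg_pos.mpr ha) hn]
      · show 0 < -(σ (a * 2))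
        simp only [map_mul, map_ofNat]
        linarith
      · show 0 < -(σ ((ε * b) * (2 * q.n)))
        simp only [map_mul, map_ofNat]
        nlinarith [mul_pos (neg_pos.mpr hb) hn]
      · show 0 < -(σ ((ε * b) * 2))
        simp only [map_mul, map_ofNat]
        linarith
    rw [diagonal_neg, posDef_diagonal_iff]
    intro i
    exact key _

/-- The transported plane has the Gram matrix of the original. -/
theorem withTransportedTorus_B (W : PlaneData k) (g g' : Matrix (Fin 4) (Fin 4) k) (hgg' : g * g' = 1)
    (hg'g : g' * g = 1) (hgΩ : g * W.Ω = W.Ω * g) :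
    (W.withTransportedTorus g g' hgg' hg'g hgΩ).B = W.B := rfl

/-- **`IsDefinite` is preserved by transporting the second torus** (`B` is unchanged). -/
theorem isDefinite_withTransportedTorus (W : PlaneData k) (hW : IsDefinite W) (g g' : Matrix (Fin 4) (Fin 4) k)
    (hgg' : g * g' = 1) (hg'g : g' * g = 1) (hgΩ : g * W.Ω = W.Ω * g) :
    IsDefinite (W.withTransportedTorus g g' hgg' hg'g hgΩ) := by
  obtain ⟨σ, hσ⟩ := hW
  exact ⟨σ, by rw [withTransportedTorus_B]; exact hσ⟩

end Genuine

end Summit.Ventures.HodgeRepro.Tier4.Line1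

end
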